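/-
Copyright (c) 2026 the pub-hodgecm-mathlib formalisation cell (harness21).  Prover seat hodgecm-mathlib-K2E3-p12 (g3), Track B «K2-LIT» ∕ h413
(`stmt-HodgeConjecture-24833`), line `K2_E3_EllipticInputs`, row 12 (12-S): THE CAPSTONE COMPOSITION IN ITS FIX-1 FORM — U12-d₁ (and (12-Id)) FROM (U12-g), the
Lie-algebra cores (L-A_GL), (L-B_GL) and the REPAIRED unitary cores (L-A_U)′, (L-B_U)′ («`ψ` non-trivial on the `σ_w`-fixed field»), and the descent socket (12-D).
2026-09-04.
-/
import Summits.HodgeConjecture.HodgeConjecture.Theorems.K2E3NormalizedCharBddOnCayleySliceOfLieCore   -- ★ p856314 (K2E3-p12 g2): the unrepaired capstone and everything it imports (model transports, Lie-bound files, `adeleAddCharAt`)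
import Literature.NumberTheory.Automorphic.AdeleAddCharGaloisEquivariance                               -- ★ p856471 (K2E3-p12 g3): `IsCMField.exists_fixed_adeleAddCharAt_ne_one`

/-!
# K2_E3 road (h413), unit U12-d — THE CAPSTONE IN FIX-1 FORM: U12-d₁ ⟸ (U12-g) + (L-A_GL) + (L-B_GL) + (L-A_U)′ + (L-B_U)′ + (12-D)

Cell `pub/hodgecm-mathlib` (D-0151), Track B (21-frontier RULING «PUSH BOTH» 2026-09-03, director req624), seat K2E3-p12 (g3), line lead of row 12 (12-S).
`--supports stmt-HodgeConjecture-24833 --as helper`; THEOREMS ONLY (no definition ∕ instance ∕ notation ∕ named fact ∕ `sorry`); never imports `Cruxes/…/Lines`.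

WHY A SECOND EDITION-BY-FILE.  Refuter K2E3-r01 (g2) FIX-1 (K2 bus 2026-09-04T01:17:58Z, dealer K2E3-plan (g2) RULING (R-a) 01:19:47Z): the unitary Lie core (L-B_U)
`subsig_K2E3UNilpotentFourierRegular` of SUBSIGS v2 is FALSE AS STATED — it quantifies over every continuous non-trivial `ψ : L_w → 𝕊`, but the kernel of
★ `lieFourier σ_w H_w ψ μ` only sees `tr(YX)` for `X, Y ∈ 𝔲(σ_w, H_w)`, which is `σ_w`-fixed, so a `ψ` trivial on the fixed field `L⁺_v ⊂ L_w` (e.g.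
`ψ_w((z∕δ)(x − σ_w x))`) makes the transform blind; (L-A_U) at such `ψ` is merely trivially satisfiable.  REPAIR C′ (option (a), adopted): in BOTH unitary cores insert,
right after `ψ.IsContinuousNontrivial →`, the antecedent `(∃ a : w.1.adicCompletion L, galAdicCompletionMap (L := L) (IsCMField.complexConj L) hw a = a ∧ ψ a ≠ 1) →`
(«`ψ` non-trivial on the `σ_w`-fixed field»; then `ψ∘tr` is a non-degenerate bicharacter of `𝔲`, `𝔲 ⊗_{L⁺_v} L_w = 𝔤𝔩_N(L_w)`, and the socket is HC1999 Thm. 4.4 verbatim).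
The ★ capstone p856314 (≤ 400 lines, append-only) cannot host the re-cut, so this file restates its two theorems over the PRIMED cores — statements otherwise
byte-identical — and re-runs the p856314 proof, discharging the new antecedent for the consumer's character `ψ_w = adeleAddCharAt L w.1` by ★
`IsCMField.exists_fixed_adeleAddCharAt_ne_one` (Galois equivariance `ψ_w ∘ σ_w = ψ_w` of Tate's character + `ψ_w ≢ 1`):
* §1 **`normalizedCharBddNearIdentity_of_lieCore'`** — (12-Id) ⟸ (U12-g) + (L-A_GL) + (L-B_GL) + (L-A_U)′ + (L-B_U)′;
* §2 **`normalizedCharBddOnCayleySlice_of_lieCore'`** — SOCKET U12-d₁ (`sig_K2E3NormalizedCharBddOnCayleySlice`, ED. 5 :214 VERBATIM) ⟸ the same five + (12-D)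
  (★ p855952 `normalizedCharBddOnCayleySlice_of_identity_of_descent`).
The hypotheses `hAU`, `hBU` below ARE the bytes of `subsig_K2E3ULieCharExpansionAtOne` ∕ `subsig_K2E3UNilpotentFourierRegular` of SUBSIGS v3
(`K2/K2E3-p12/g3/SUBSIGS-U12d-LieCore.v3.K2E3-p12-g3.lean`); `hAGL`, `hBGL`, `hD` are unchanged from v2 ∕ p856314.
[HarishChandra1999AdmissibleDistributions, Thm. 4.4 p. 11, Thm. 16.3 p. 77, §21 p. 87] [Howe1974, Prop. 3, Lemma 4] [PlatonovRapinchuk1994, §5.1] [Tate1950, §2.2].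
HONEST LABEL: HC_CM is proved only modulo the 7 printed citations (2 remaining named inputs: hLiu418 = stmt-HodgeConjecture-24832, h413 =
stmt-HodgeConjecture-24833) until rung 0 closes; compositions only — the five cores and (12-D) are NOT proved here.

## References
* [HarishChandra1999AdmissibleDistributions] Harish-Chandra (DeBacker–Sally), *Admissible Invariant Distributions on Reductive p-adic Groups* (1999), Thm. 4.4, Thm. 16.3, §21.
* [Howe1974] R. Howe, *The Fourier transform and germs of characters (case of GL_n over a p-adic field)*, Math. Ann. 208 (1974), 305–322.
* [PlatonovRapinchuk1994] V. Platonov, A. Rapinchuk, *Algebraic Groups and Number Theory* (1994), §5.1.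
* [Tate1950] J. Tate, *Fourier analysis in number fields and Hecke's zeta-functions* (1950), §2.2.
-/

set_option autoImplicit false
set_option linter.dupNamespace false   -- `Summit.HodgeConjecture.HodgeConjecture.…` (D-0017 nested layout; lakefile exemption for Summits)

noncomputable section

open NumberField IsDedekindDomain MeasureTheory Measure Filter Topology Polynomial
open scoped Matrix MatrixGroups NNReal
open Literature.NumberTheory.Rogawski1990 Literature.NumberTheory.Automorphic Literature.NumberTheory.Automorphic.UnitaryGroup
open Literature.NumberTheory.GaloisRepresentations Literature.NumberTheory.GaloisRepresentations.IsNonarchimedeanLocalField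
open Summit.HodgeConjecture.HodgeConjecture.Cruxes.H413.K2E3LieUnitary
open Summit.HodgeConjecture.HodgeConjecture.Cruxes.H413.K2E3NormalizedCharBddNearModelTransport
open Summit.HodgeConjecture.HodgeConjecture.Cruxes.H413.K2E3NormalizedCharBddNearModelTransportSplit
open Summit.HodgeConjecture.HodgeConjecture.Cruxes.H413.K2E3GLnNormalizedCharBddNearIdentityOfLieCore
open Summit.HodgeConjecture.HodgeConjecture.Cruxes.H413.K2E3UNormalizedCharBddNearIdentityOfLieCore
open Summit.HodgeConjecture.HodgeConjecture.Cruxes.H413.K2E3NormalizedCharBddNearSemisimpleOfIdentityDescent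

namespace Summit.HodgeConjecture.HodgeConjecture.Cruxes.H413.K2E3NormalizedCharBddOnCayleySliceOfLieCoreFixed

/-! ## §1  (12-Id) at every place from the four Lie-algebra core statements (unitary ones in FIX-1 form) -/

set_option maxHeartbeats 1600000 in
set_option synthInstance.maxHeartbeats 400000 in
open scoped Classical in
/-- **(12-Id) ⟸ (U12-g) + (L-A_GL) + (L-B_GL) + (L-A_U)′ + (L-B_U)′** (FIX-1 form: the U-cores carry the antecedent «`ψ` non-trivial on the `σ_w`-fixed field», discharged for `ψ_w` by ★ `IsCMField.exists_fixed_adeleAddCharAt_ne_one`) — `√√‖u‖·|Θ_π|` is bounded near the identity of `U_N(H)(L⁺_v)` (every `N`, every place `v`), from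
admissibility and the local character expansion ∕ Harish-Chandra's Thm. 4.4 on `𝔤𝔩_N(L_w)` (split `w ∣ v`) and on `𝔲(σ_w, H_w)` (non-split `w`).
[cite: HarishChandra1999AdmissibleDistributions, Thm. 4.4 p. 11, Thm. 16.3 p. 77, §21 p. 87] [cite: Howe1974, Prop. 3, Lemma 4] [cite: PlatonovRapinchuk1994, §5.1] -/
theorem normalizedCharBddNearIdentity_of_lieCore'
    (hg : ∀ (L : Type) [Field L] [NumberField L] [IsCMField L] (N : ℕ) (H : Matrix (Fin N) (Fin N) L), UnitaryGroup.LocalIrrepAdmissible L N H)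
    (hAGL : ∀ (F : Type) [Field F] [ValuativeRel F] [TopologicalSpace F] [IsNonarchimedeanLocalField F] [CharZero F] (N : ℕ)
      (ψ : AddChar F Circle), ψ.IsContinuousNontrivial →
      ∀ [MeasurableSpace (Matrix (Fin N) (Fin N) F)] [BorelSpace (Matrix (Fin N) (Fin N) F)] (μ𝔤 : Measure (Matrix (Fin N) (Fin N) F)) [μ𝔤.IsAddHaarMeasure]
        [MeasurableSpace (GL (Fin N) F)] [BorelSpace (GL (Fin N) F)] (μ₀ : Measure (GL (Fin N) F)) [μ₀.IsHaarMeasure]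
        (r₀ : SmoothIrrep (GL (Fin N) F)), r₀.ρ.IsAdmissible → ∀ Θ₀ : GL (Fin N) F → ℂ,
        (∀ x₀ : GL (Fin N) F, IsRegularElt x₀ → ∀ᶠ y in 𝓝 x₀, Θ₀ y = Θ₀ x₀) →
        (∀ φ₀ : GL (Fin N) F → ℂ, IsLocSmooth φ₀ → (IrrClass.mk r₀).smoothTrace μ₀ φ₀ = ∫ x, φ₀ x * Θ₀ x ∂μ₀) →
      ∃ V : Set (Matrix (Fin N) (Fin N) F), V ∈ 𝓝 (0 : Matrix (Fin N) (Fin N) F) ∧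
      ∃ T : (Matrix (Fin N) (Fin N) F → ℂ) → ℂ,
        ((∀ f₁ f₂ : Matrix (Fin N) (Fin N) F → ℂ, IsLocSmooth f₁ → IsLocSmooth f₂ → T (f₁ + f₂) = T f₁ + T f₂) ∧
         (∀ (a : ℂ) (f : Matrix (Fin N) (Fin N) F → ℂ), IsLocSmooth f → T (a • f) = a * T f) ∧
         (∀ (x : GL (Fin N) F) (f : Matrix (Fin N) (Fin N) F → ℂ), IsLocSmooth f →
            T (fun X => f ((x : Matrix (Fin N) (Fin N) F) * X * ((x⁻¹ : GL (Fin N) F) : Matrix (Fin N) (Fin N) F))) = T f) ∧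
         (∀ f : Matrix (Fin N) (Fin N) F → ℂ, IsLocSmooth f → (∀ X ∈ tsupport f, ¬ IsNilpotent X) → T f = 0)) ∧
        ∀ Fn : Matrix (Fin N) (Fin N) F → ℂ,
          (∀ f : Matrix (Fin N) (Fin N) F → ℂ, IsLocSmooth f →
              T (fun Y => ∫ X, ((ψ (Matrix.trace (Y * X)) : Circle) : ℂ) * f X ∂μ𝔤) = ∫ X, f X * Fn X ∂μ𝔤) →
          (∀ X : Matrix (Fin N) (Fin N) F, IsUnit X.charpoly.discr → ∀ᶠ Y in 𝓝 X, Fn Y = Fn X) →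
          ∀ g : GL (Fin N) F, ∀ Y ∈ V, IsUnit Y.charpoly.discr → IsUnit (1 - Y) → IsUnit (1 + Y) →
            (g : Matrix (Fin N) (Fin N) F) = (1 + Y) * (1 - Y)⁻¹ → Θ₀ g = Fn Y)
    (hBGL : ∀ (F : Type) [Field F] [ValuativeRel F] [TopologicalSpace F] [IsNonarchimedeanLocalField F] [CharZero F] (N : ℕ)
      (ψ : AddChar F Circle), ψ.IsContinuousNontrivial →
      ∀ [MeasurableSpace (Matrix (Fin N) (Fin N) F)] [BorelSpace (Matrix (Fin N) (Fin N) F)] (μ𝔤 : Measure (Matrix (Fin N) (Fin N) F)) [μ𝔤.IsAddHaarMeasure],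
      ∀ T : (Matrix (Fin N) (Fin N) F → ℂ) → ℂ,
        ((∀ f₁ f₂ : Matrix (Fin N) (Fin N) F → ℂ, IsLocSmooth f₁ → IsLocSmooth f₂ → T (f₁ + f₂) = T f₁ + T f₂) ∧
         (∀ (a : ℂ) (f : Matrix (Fin N) (Fin N) F → ℂ), IsLocSmooth f → T (a • f) = a * T f) ∧
         (∀ (x : GL (Fin N) F) (f : Matrix (Fin N) (Fin N) F → ℂ), IsLocSmooth f →
            T (fun X => f ((x : Matrix (Fin N) (Fin N) F) * X * ((x⁻¹ : GL (Fin N) F) : Matrix (Fin N) (Fin N) F))) = T f) ∧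
         (∀ f : Matrix (Fin N) (Fin N) F → ℂ, IsLocSmooth f → (∀ X ∈ tsupport f, ¬ IsNilpotent X) → T f = 0)) →
        ∃ Fn : Matrix (Fin N) (Fin N) F → ℂ, LocallyIntegrable Fn μ𝔤 ∧
          (∀ f : Matrix (Fin N) (Fin N) F → ℂ, IsLocSmooth f →
              T (fun Y => ∫ X, ((ψ (Matrix.trace (Y * X)) : Circle) : ℂ) * f X ∂μ𝔤) = ∫ X, f X * Fn X ∂μ𝔤) ∧
          (∀ X : Matrix (Fin N) (Fin N) F, IsUnit X.charpoly.discr → ∀ᶠ Y in 𝓝 X, Fn Y = Fn X) ∧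
          (∀ C : Set (Matrix (Fin N) (Fin N) F), IsCompact C → ∃ B : ℝ, ∀ X ∈ C,
              ((NNReal.sqrt (normAbs F X.charpoly.discr) : ℝ≥0) : ℝ) * ‖Fn X‖ ≤ B))
    (hAU : ∀ (L : Type) [Field L] [NumberField L] [IsCMField L] (N : ℕ) (H : Matrix (Fin N) (Fin N) L),
      (H.map (cmConjRingHom L))ᵀ = H → H.det ≠ 0 →
      ∀ (v : HeightOneSpectrum (𝓞 ↥(maximalRealSubfield L))) (w : UnitaryGroup.PlacesOver L v) (hw : IsCMField.complexConj L • w.1 = w.1)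
      (ψ : AddChar (w.1.adicCompletion L) Circle), ψ.IsContinuousNontrivial →
      (∃ a : w.1.adicCompletion L, galAdicCompletionMap (L := L) (IsCMField.complexConj L) hw a = a ∧ ψ a ≠ 1) →
      ∀ [MeasurableSpace ↥(lieOfForm (galAdicCompletionMap (L := L) (IsCMField.complexConj L) hw) (UnitaryGroup.placeForm H w.1))]
        [BorelSpace ↥(lieOfForm (galAdicCompletionMap (L := L) (IsCMField.complexConj L) hw) (UnitaryGroup.placeForm H w.1))]
        (μ𝔤 : Measure ↥(lieOfForm (galAdicCompletionMap (L := L) (IsCMField.complexConj L) hw) (UnitaryGroup.placeForm H w.1))) [μ𝔤.IsAddHaarMeasure]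
        [MeasurableSpace ↥(unitaryGroupOfForm (galAdicCompletionMap (L := L) (IsCMField.complexConj L) hw) (UnitaryGroup.placeForm H w.1))]
        [BorelSpace ↥(unitaryGroupOfForm (galAdicCompletionMap (L := L) (IsCMField.complexConj L) hw) (UnitaryGroup.placeForm H w.1))]
        (μ₀ : Measure ↥(unitaryGroupOfForm (galAdicCompletionMap (L := L) (IsCMField.complexConj L) hw) (UnitaryGroup.placeForm H w.1))) [μ₀.IsHaarMeasure]
        (r₀ : SmoothIrrep ↥(unitaryGroupOfForm (galAdicCompletionMap (L := L) (IsCMField.complexConj L) hw) (UnitaryGroup.placeForm H w.1))), r₀.ρ.IsAdmissible →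
        ∀ Θ₀ : ↥(unitaryGroupOfForm (galAdicCompletionMap (L := L) (IsCMField.complexConj L) hw) (UnitaryGroup.placeForm H w.1)) → ℂ,
        (∀ x₀ : ↥(unitaryGroupOfForm (galAdicCompletionMap (L := L) (IsCMField.complexConj L) hw) (UnitaryGroup.placeForm H w.1)),
          IsRegularElt (x₀ : GL (Fin N) (w.1.adicCompletion L)) → ∀ᶠ y in 𝓝 x₀, Θ₀ y = Θ₀ x₀) →
        (∀ φ₀ : ↥(unitaryGroupOfForm (galAdicCompletionMap (L := L) (IsCMField.complexConj L) hw) (UnitaryGroup.placeForm H w.1)) → ℂ,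
          IsLocSmooth φ₀ → (IrrClass.mk r₀).smoothTrace μ₀ φ₀ = ∫ x, φ₀ x * Θ₀ x ∂μ₀) →
      ∃ V : Set (Matrix (Fin N) (Fin N) (w.1.adicCompletion L)), V ∈ 𝓝 (0 : Matrix (Fin N) (Fin N) (w.1.adicCompletion L)) ∧
      ∃ T : (↥(lieOfForm (galAdicCompletionMap (L := L) (IsCMField.complexConj L) hw) (UnitaryGroup.placeForm H w.1)) → ℂ) → ℂ,
        ((∀ f₁ f₂ : ↥(lieOfForm (galAdicCompletionMap (L := L) (IsCMField.complexConj L) hw) (UnitaryGroup.placeForm H w.1)) → ℂ, IsLocSmooth f₁ → IsLocSmooth f₂ → T (f₁ + f₂) = T f₁ + T f₂) ∧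
         (∀ (a : ℂ) (f : ↥(lieOfForm (galAdicCompletionMap (L := L) (IsCMField.complexConj L) hw) (UnitaryGroup.placeForm H w.1)) → ℂ), IsLocSmooth f → T (a • f) = a * T f) ∧
         (∀ (x : ↥(unitaryGroupOfForm (galAdicCompletionMap (L := L) (IsCMField.complexConj L) hw) (UnitaryGroup.placeForm H w.1))) (f : ↥(lieOfForm (galAdicCompletionMap (L := L) (IsCMField.complexConj L) hw) (UnitaryGroup.placeForm H w.1)) → ℂ), IsLocSmooth f →
            T (fun X => f ⟨((x : GL (Fin N) (w.1.adicCompletion L)) : Matrix (Fin N) (Fin N) (w.1.adicCompletion L)) * X.1 * (((x : GL (Fin N) (w.1.adicCompletion L))⁻¹ : GL (Fin N) (w.1.adicCompletion L)) : Matrix (Fin N) (Fin N) (w.1.adicCompletion L)),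
              conj_mem_lieOfForm x.2 X.2⟩) = T f) ∧
         (∀ f : ↥(lieOfForm (galAdicCompletionMap (L := L) (IsCMField.complexConj L) hw) (UnitaryGroup.placeForm H w.1)) → ℂ, IsLocSmooth f → (∀ X ∈ tsupport f, ¬ IsNilpotent X.1) → T f = 0)) ∧
        ∀ Fn : ↥(lieOfForm (galAdicCompletionMap (L := L) (IsCMField.complexConj L) hw) (UnitaryGroup.placeForm H w.1)) → ℂ,
          (∀ f : ↥(lieOfForm (galAdicCompletionMap (L := L) (IsCMField.complexConj L) hw) (UnitaryGroup.placeForm H w.1)) → ℂ, IsLocSmooth f → T (lieFourier (galAdicCompletionMap (L := L) (IsCMField.complexConj L) hw) (UnitaryGroup.placeForm H w.1) (fun x : w.1.adicCompletion L => ((ψ x : Circle) : ℂ)) μ𝔤 f) = ∫ X, f X * Fn X ∂μ𝔤) →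
          (∀ X : ↥(lieOfForm (galAdicCompletionMap (L := L) (IsCMField.complexConj L) hw) (UnitaryGroup.placeForm H w.1)), IsUnit X.1.charpoly.discr → ∀ᶠ Y in 𝓝 X, Fn Y = Fn X) →
          ∀ g : ↥(unitaryGroupOfForm (galAdicCompletionMap (L := L) (IsCMField.complexConj L) hw) (UnitaryGroup.placeForm H w.1)), ∀ Y : ↥(lieOfForm (galAdicCompletionMap (L := L) (IsCMField.complexConj L) hw) (UnitaryGroup.placeForm H w.1)), Y.1 ∈ V → IsUnit Y.1.charpoly.discr → IsUnit (1 - Y.1) → IsUnit (1 + Y.1) →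
            ((g : GL (Fin N) (w.1.adicCompletion L)) : Matrix (Fin N) (Fin N) (w.1.adicCompletion L)) = (1 + Y.1) * (1 - Y.1)⁻¹ → Θ₀ g = Fn Y)
    (hBU : ∀ (L : Type) [Field L] [NumberField L] [IsCMField L] (N : ℕ) (H : Matrix (Fin N) (Fin N) L),
      (H.map (cmConjRingHom L))ᵀ = H → H.det ≠ 0 →
      ∀ (v : HeightOneSpectrum (𝓞 ↥(maximalRealSubfield L))) (w : UnitaryGroup.PlacesOver L v) (hw : IsCMField.complexConj L • w.1 = w.1)
      (ψ : AddChar (w.1.adicCompletion L) Circle), ψ.IsContinuousNontrivial →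
      (∃ a : w.1.adicCompletion L, galAdicCompletionMap (L := L) (IsCMField.complexConj L) hw a = a ∧ ψ a ≠ 1) →
      ∀ [MeasurableSpace ↥(lieOfForm (galAdicCompletionMap (L := L) (IsCMField.complexConj L) hw) (UnitaryGroup.placeForm H w.1))]
        [BorelSpace ↥(lieOfForm (galAdicCompletionMap (L := L) (IsCMField.complexConj L) hw) (UnitaryGroup.placeForm H w.1))]
        (μ𝔤 : Measure ↥(lieOfForm (galAdicCompletionMap (L := L) (IsCMField.complexConj L) hw) (UnitaryGroup.placeForm H w.1))) [μ𝔤.IsAddHaarMeasure],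
      ∀ T : (↥(lieOfForm (galAdicCompletionMap (L := L) (IsCMField.complexConj L) hw) (UnitaryGroup.placeForm H w.1)) → ℂ) → ℂ,
        ((∀ f₁ f₂ : ↥(lieOfForm (galAdicCompletionMap (L := L) (IsCMField.complexConj L) hw) (UnitaryGroup.placeForm H w.1)) → ℂ, IsLocSmooth f₁ → IsLocSmooth f₂ → T (f₁ + f₂) = T f₁ + T f₂) ∧
         (∀ (a : ℂ) (f : ↥(lieOfForm (galAdicCompletionMap (L := L) (IsCMField.complexConj L) hw) (UnitaryGroup.placeForm H w.1)) → ℂ), IsLocSmooth f → T (a • f) = a * T f) ∧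
         (∀ (x : ↥(unitaryGroupOfForm (galAdicCompletionMap (L := L) (IsCMField.complexConj L) hw) (UnitaryGroup.placeForm H w.1))) (f : ↥(lieOfForm (galAdicCompletionMap (L := L) (IsCMField.complexConj L) hw) (UnitaryGroup.placeForm H w.1)) → ℂ), IsLocSmooth f →
            T (fun X => f ⟨((x : GL (Fin N) (w.1.adicCompletion L)) : Matrix (Fin N) (Fin N) (w.1.adicCompletion L)) * X.1 * (((x : GL (Fin N) (w.1.adicCompletion L))⁻¹ : GL (Fin N) (w.1.adicCompletion L)) : Matrix (Fin N) (Fin N) (w.1.adicCompletion L)),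
              conj_mem_lieOfForm x.2 X.2⟩) = T f) ∧
         (∀ f : ↥(lieOfForm (galAdicCompletionMap (L := L) (IsCMField.complexConj L) hw) (UnitaryGroup.placeForm H w.1)) → ℂ, IsLocSmooth f → (∀ X ∈ tsupport f, ¬ IsNilpotent X.1) → T f = 0)) →
        ∃ Fn : ↥(lieOfForm (galAdicCompletionMap (L := L) (IsCMField.complexConj L) hw) (UnitaryGroup.placeForm H w.1)) → ℂ, LocallyIntegrable Fn μ𝔤 ∧
          (∀ f : ↥(lieOfForm (galAdicCompletionMap (L := L) (IsCMField.complexConj L) hw) (UnitaryGroup.placeForm H w.1)) → ℂ, IsLocSmooth f → T (lieFourier (galAdicCompletionMap (L := L) (IsCMField.complexConj L) hw) (UnitaryGroup.placeForm H w.1) (fun x : w.1.adicCompletion L => ((ψ x : Circle) : ℂ)) μ𝔤 f) = ∫ X, f X * Fn X ∂μ𝔤) ∧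
          (∀ X : ↥(lieOfForm (galAdicCompletionMap (L := L) (IsCMField.complexConj L) hw) (UnitaryGroup.placeForm H w.1)), IsUnit X.1.charpoly.discr → ∀ᶠ Y in 𝓝 X, Fn Y = Fn X) ∧
          (∀ C : Set ↥(lieOfForm (galAdicCompletionMap (L := L) (IsCMField.complexConj L) hw) (UnitaryGroup.placeForm H w.1)), IsCompact C → ∃ B : ℝ, ∀ X ∈ C,
              ((NNReal.sqrt (NNReal.sqrt (normAbs (w.1.adicCompletion L) X.1.charpoly.discr)) : ℝ≥0) : ℝ) * ‖Fn X‖ ≤ B)) :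
    ∀ (L : Type) [Field L] [NumberField L] [IsCMField L] (N : ℕ) (H : Matrix (Fin N) (Fin N) L),
      (H.map (cmConjRingHom L))ᵀ = H → H.det ≠ 0 →
      ∀ (v : HeightOneSpectrum (𝓞 ↥(maximalRealSubfield L)))
        [MeasurableSpace ((UnitaryGroup.cmDatum L N H).Local v)] [BorelSpace ((UnitaryGroup.cmDatum L N H).Local v)]
        (μ : Measure ((UnitaryGroup.cmDatum L N H).Local v)) [μ.IsHaarMeasure]
        (c : IrrClass ((UnitaryGroup.cmDatum L N H).Local v)) (Θ : (UnitaryGroup.cmDatum L N H).Local v → ℂ),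
        LocallyIntegrable Θ μ →
        (∀ x : (UnitaryGroup.cmDatum L N H).Local v,
          IsRegularElt (x.val : GL (Fin N) (UnitaryGroup.LocalRing L v)) → ∀ᶠ y in 𝓝 x, Θ y = Θ x) →
        (∀ φ : (UnitaryGroup.cmDatum L N H).Local v → ℂ, IsLocSmooth φ → c.smoothTrace μ φ = ∫ x, φ x * Θ x ∂μ) →
        ∃ U : Set ((UnitaryGroup.cmDatum L N H).Local v), IsOpen U ∧ (1 : (UnitaryGroup.cmDatum L N H).Local v) ∈ U ∧
        ∃ B : ℝ, ∀ g ∈ U, ∀ u : (UnitaryGroup.LocalRing L v)ˣ,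
          (u : UnitaryGroup.LocalRing L v) *
              (((g.val : GL (Fin N) (UnitaryGroup.LocalRing L v)).val : Matrix (Fin N) (Fin N) (UnitaryGroup.LocalRing L v)).det) ^ (N - 1) =
            (((g.val : GL (Fin N) (UnitaryGroup.LocalRing L v)).val : Matrix (Fin N) (Fin N) (UnitaryGroup.LocalRing L v)).charpoly).discr →
          ((NNReal.sqrt (NNReal.sqrt (unitModulusChar (UnitaryGroup.LocalRing L v) u)) : ℝ≥0) : ℝ) * ‖Θ g‖ ≤ B := by
  intro L _ _ _ N H hH hHd v _ _ μ _ c Θ _ hloc hrep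
  have hadm : c.IsAdmissible := hg L N H hH (isUnit_iff_ne_zero.2 hHd) v c
  obtain ⟨w⟩ := (inferInstance : Nonempty (UnitaryGroup.PlacesOver L v))
  haveI : CharZero (w.1.adicCompletion L) := charZero_of_injective_algebraMap (algebraMap L (w.1.adicCompletion L)).injective
  have h2 : (2 : w.1.adicCompletion L) ≠ 0 := two_ne_zero
  -- the local component `ψ_w` of the standard adelic additive character: continuous and non-trivial
  have hψ := isContinuousNontrivial_adeleAddCharAt L w.1
  haveI : LocallyCompactSpace (Matrix (Fin N) (Fin N) (w.1.adicCompletion L)) :=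
    inferInstanceAs (LocallyCompactSpace (Fin N → Fin N → w.1.adicCompletion L))
  by_cases hw : IsCMField.complexConj L • w.1 = w.1
  · -- NON-SPLIT place: the one-place unitary model `U(σ_w, H_w)(L_w)` and its Lie algebra `𝔲 = ↥(lieOfForm σ_w H_w)`;
    -- `ψ_w` is non-trivial on the `σ_w`-fixed field (★ `IsCMField.exists_fixed_adeleAddCharAt_ne_one`)
    have hfix := IsCMField.exists_fixed_adeleAddCharAt_ne_one L hw
    refine normalizedCharBddNearIdentity_of_nonsplit L N H v w hw (fun μ₀ _ r₀ hr₀ Θ₀ hl₀ hr₀' => ?_) μ c hadm Θ hloc hrep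
    have hσ : Continuous (galAdicCompletionMap (L := L) (IsCMField.complexConj L) hw) :=
      continuous_galAdicCompletionMap (L := L) (IsCMField.complexConj L) hw
    letI : MeasurableSpace ↥(lieOfForm (galAdicCompletionMap (L := L) (IsCMField.complexConj L) hw) (UnitaryGroup.placeForm H w.1)) := borel _
    haveI : BorelSpace ↥(lieOfForm (galAdicCompletionMap (L := L) (IsCMField.complexConj L) hw) (UnitaryGroup.placeForm H w.1)) := ⟨rfl⟩
    haveI : LocallyCompactSpace ↥(lieOfForm (galAdicCompletionMap (L := L) (IsCMField.complexConj L) hw) (UnitaryGroup.placeForm H w.1)) :=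
      (Topology.IsClosedEmbedding.subtypeVal
        (isClosed_lieOfForm (σ := galAdicCompletionMap (L := L) (IsCMField.complexConj L) hw) (J := UnitaryGroup.placeForm H w.1) hσ)).locallyCompactSpace
    exact uNormalizedCharBddNearOne_of_lieBound _ _ h2 Θ₀
      (uLieBound_of_lieCore _ _ hσ Measure.addHaar (fun x : w.1.adicCompletion L => ((adeleAddCharAt L w.1 x : Circle) : ℂ)) Θ₀
        (hAU L N H hH hHd v w hw (adeleAddCharAt L w.1) hψ hfix Measure.addHaar μ₀ r₀ hr₀ Θ₀ hl₀ hr₀')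
        (hBU L N H hH hHd v w hw (adeleAddCharAt L w.1) hψ hfix Measure.addHaar))
  · -- SPLIT place: the model `GL_N(L_w)` and its Lie algebra `𝔤𝔩_N(L_w) = M_N(L_w)`
    refine normalizedCharBddNearIdentity_of_split L N H v hH hHd w hw (fun μ₀ _ r₀ hr₀ Θ₀ hl₀ hr₀' => ?_) μ c hadm Θ hloc hrep
    letI : MeasurableSpace (Matrix (Fin N) (Fin N) (w.1.adicCompletion L)) := borel _
    haveI : BorelSpace (Matrix (Fin N) (Fin N) (w.1.adicCompletion L)) := ⟨rfl⟩
    exact normalizedCharBddNearOne_of_lieBound h2 Θ₀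
      (lieBound_of_lieCore Measure.addHaar (fun x : w.1.adicCompletion L => ((adeleAddCharAt L w.1 x : Circle) : ℂ)) Θ₀
        (hAGL (w.1.adicCompletion L) N (adeleAddCharAt L w.1) hψ Measure.addHaar μ₀ r₀ hr₀ Θ₀ hl₀ hr₀')
        (hBGL (w.1.adicCompletion L) N (adeleAddCharAt L w.1) hψ Measure.addHaar))

/-! ## §2  The residual socket U12-d₁ from the four (repaired) Lie-algebra core statements and the descent socket -/

set_option maxHeartbeats 1600000 in
set_option synthInstance.maxHeartbeats 400000 in
open scoped Classical in
/-- **SOCKET U12-d₁ ⟸ (U12-g) + (L-A_GL) + (L-B_GL) + (L-A_U)′ + (L-B_U)′ + (12-D)** (FIX-1 form) — `sig_K2E3NormalizedCharBddOnCayleySlice` (ED. 5 :214) VERBATIM as conclusion: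
§1 and the descent socket fed into ★ `normalizedCharBddOnCayleySlice_of_identity_of_descent` (p855952).
[cite: HarishChandra1999AdmissibleDistributions, Thm. 4.4 p. 11, Thm. 16.3 p. 77, §21 p. 87] [cite: Howe1974, Prop. 3, Lemma 4] -/
theorem normalizedCharBddOnCayleySlice_of_lieCore'
    (hg : ∀ (L : Type) [Field L] [NumberField L] [IsCMField L] (N : ℕ) (H : Matrix (Fin N) (Fin N) L), UnitaryGroup.LocalIrrepAdmissible L N H)
    (hAGL : ∀ (F : Type) [Field F] [ValuativeRel F] [TopologicalSpace F] [IsNonarchimedeanLocalField F] [CharZero F] (N : ℕ)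
      (ψ : AddChar F Circle), ψ.IsContinuousNontrivial →
      ∀ [MeasurableSpace (Matrix (Fin N) (Fin N) F)] [BorelSpace (Matrix (Fin N) (Fin N) F)] (μ𝔤 : Measure (Matrix (Fin N) (Fin N) F)) [μ𝔤.IsAddHaarMeasure]
        [MeasurableSpace (GL (Fin N) F)] [BorelSpace (GL (Fin N) F)] (μ₀ : Measure (GL (Fin N) F)) [μ₀.IsHaarMeasure]
        (r₀ : SmoothIrrep (GL (Fin N) F)), r₀.ρ.IsAdmissible → ∀ Θ₀ : GL (Fin N) F → ℂ,
        (∀ x₀ : GL (Fin N) F, IsRegularElt x₀ → ∀ᶠ y in 𝓝 x₀, Θ₀ y = Θ₀ x₀) →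
        (∀ φ₀ : GL (Fin N) F → ℂ, IsLocSmooth φ₀ → (IrrClass.mk r₀).smoothTrace μ₀ φ₀ = ∫ x, φ₀ x * Θ₀ x ∂μ₀) →
      ∃ V : Set (Matrix (Fin N) (Fin N) F), V ∈ 𝓝 (0 : Matrix (Fin N) (Fin N) F) ∧
      ∃ T : (Matrix (Fin N) (Fin N) F → ℂ) → ℂ,
        ((∀ f₁ f₂ : Matrix (Fin N) (Fin N) F → ℂ, IsLocSmooth f₁ → IsLocSmooth f₂ → T (f₁ + f₂) = T f₁ + T f₂) ∧
         (∀ (a : ℂ) (f : Matrix (Fin N) (Fin N) F → ℂ), IsLocSmooth f → T (a • f) = a * T f) ∧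
         (∀ (x : GL (Fin N) F) (f : Matrix (Fin N) (Fin N) F → ℂ), IsLocSmooth f →
            T (fun X => f ((x : Matrix (Fin N) (Fin N) F) * X * ((x⁻¹ : GL (Fin N) F) : Matrix (Fin N) (Fin N) F))) = T f) ∧
         (∀ f : Matrix (Fin N) (Fin N) F → ℂ, IsLocSmooth f → (∀ X ∈ tsupport f, ¬ IsNilpotent X) → T f = 0)) ∧
        ∀ Fn : Matrix (Fin N) (Fin N) F → ℂ,
          (∀ f : Matrix (Fin N) (Fin N) F → ℂ, IsLocSmooth f →
              T (fun Y => ∫ X, ((ψ (Matrix.trace (Y * X)) : Circle) : ℂ) * f X ∂μ𝔤) = ∫ X, f X * Fn X ∂μ𝔤) →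
          (∀ X : Matrix (Fin N) (Fin N) F, IsUnit X.charpoly.discr → ∀ᶠ Y in 𝓝 X, Fn Y = Fn X) →
          ∀ g : GL (Fin N) F, ∀ Y ∈ V, IsUnit Y.charpoly.discr → IsUnit (1 - Y) → IsUnit (1 + Y) →
            (g : Matrix (Fin N) (Fin N) F) = (1 + Y) * (1 - Y)⁻¹ → Θ₀ g = Fn Y)
    (hBGL : ∀ (F : Type) [Field F] [ValuativeRel F] [TopologicalSpace F] [IsNonarchimedeanLocalField F] [CharZero F] (N : ℕ)
      (ψ : AddChar F Circle), ψ.IsContinuousNontrivial →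
      ∀ [MeasurableSpace (Matrix (Fin N) (Fin N) F)] [BorelSpace (Matrix (Fin N) (Fin N) F)] (μ𝔤 : Measure (Matrix (Fin N) (Fin N) F)) [μ𝔤.IsAddHaarMeasure],
      ∀ T : (Matrix (Fin N) (Fin N) F → ℂ) → ℂ,
        ((∀ f₁ f₂ : Matrix (Fin N) (Fin N) F → ℂ, IsLocSmooth f₁ → IsLocSmooth f₂ → T (f₁ + f₂) = T f₁ + T f₂) ∧
         (∀ (a : ℂ) (f : Matrix (Fin N) (Fin N) F → ℂ), IsLocSmooth f → T (a • f) = a * T f) ∧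
         (∀ (x : GL (Fin N) F) (f : Matrix (Fin N) (Fin N) F → ℂ), IsLocSmooth f →
            T (fun X => f ((x : Matrix (Fin N) (Fin N) F) * X * ((x⁻¹ : GL (Fin N) F) : Matrix (Fin N) (Fin N) F))) = T f) ∧
         (∀ f : Matrix (Fin N) (Fin N) F → ℂ, IsLocSmooth f → (∀ X ∈ tsupport f, ¬ IsNilpotent X) → T f = 0)) →
        ∃ Fn : Matrix (Fin N) (Fin N) F → ℂ, LocallyIntegrable Fn μ𝔤 ∧
          (∀ f : Matrix (Fin N) (Fin N) F → ℂ, IsLocSmooth f →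
              T (fun Y => ∫ X, ((ψ (Matrix.trace (Y * X)) : Circle) : ℂ) * f X ∂μ𝔤) = ∫ X, f X * Fn X ∂μ𝔤) ∧
          (∀ X : Matrix (Fin N) (Fin N) F, IsUnit X.charpoly.discr → ∀ᶠ Y in 𝓝 X, Fn Y = Fn X) ∧
          (∀ C : Set (Matrix (Fin N) (Fin N) F), IsCompact C → ∃ B : ℝ, ∀ X ∈ C,
              ((NNReal.sqrt (normAbs F X.charpoly.discr) : ℝ≥0) : ℝ) * ‖Fn X‖ ≤ B))
    (hAU : ∀ (L : Type) [Field L] [NumberField L] [IsCMField L] (N : ℕ) (H : Matrix (Fin N) (Fin N) L),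
      (H.map (cmConjRingHom L))ᵀ = H → H.det ≠ 0 →
      ∀ (v : HeightOneSpectrum (𝓞 ↥(maximalRealSubfield L))) (w : UnitaryGroup.PlacesOver L v) (hw : IsCMField.complexConj L • w.1 = w.1)
      (ψ : AddChar (w.1.adicCompletion L) Circle), ψ.IsContinuousNontrivial →
      (∃ a : w.1.adicCompletion L, galAdicCompletionMap (L := L) (IsCMField.complexConj L) hw a = a ∧ ψ a ≠ 1) →
      ∀ [MeasurableSpace ↥(lieOfForm (galAdicCompletionMap (L := L) (IsCMField.complexConj L) hw) (UnitaryGroup.placeForm H w.1))]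
        [BorelSpace ↥(lieOfForm (galAdicCompletionMap (L := L) (IsCMField.complexConj L) hw) (UnitaryGroup.placeForm H w.1))]
        (μ𝔤 : Measure ↥(lieOfForm (galAdicCompletionMap (L := L) (IsCMField.complexConj L) hw) (UnitaryGroup.placeForm H w.1))) [μ𝔤.IsAddHaarMeasure]
        [MeasurableSpace ↥(unitaryGroupOfForm (galAdicCompletionMap (L := L) (IsCMField.complexConj L) hw) (UnitaryGroup.placeForm H w.1))]
        [BorelSpace ↥(unitaryGroupOfForm (galAdicCompletionMap (L := L) (IsCMField.complexConj L) hw) (UnitaryGroup.placeForm H w.1))]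
        (μ₀ : Measure ↥(unitaryGroupOfForm (galAdicCompletionMap (L := L) (IsCMField.complexConj L) hw) (UnitaryGroup.placeForm H w.1))) [μ₀.IsHaarMeasure]
        (r₀ : SmoothIrrep ↥(unitaryGroupOfForm (galAdicCompletionMap (L := L) (IsCMField.complexConj L) hw) (UnitaryGroup.placeForm H w.1))), r₀.ρ.IsAdmissible →
        ∀ Θ₀ : ↥(unitaryGroupOfForm (galAdicCompletionMap (L := L) (IsCMField.complexConj L) hw) (UnitaryGroup.placeForm H w.1)) → ℂ,
        (∀ x₀ : ↥(unitaryGroupOfForm (galAdicCompletionMap (L := L) (IsCMField.complexConj L) hw) (UnitaryGroup.placeForm H w.1)),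
          IsRegularElt (x₀ : GL (Fin N) (w.1.adicCompletion L)) → ∀ᶠ y in 𝓝 x₀, Θ₀ y = Θ₀ x₀) →
        (∀ φ₀ : ↥(unitaryGroupOfForm (galAdicCompletionMap (L := L) (IsCMField.complexConj L) hw) (UnitaryGroup.placeForm H w.1)) → ℂ,
          IsLocSmooth φ₀ → (IrrClass.mk r₀).smoothTrace μ₀ φ₀ = ∫ x, φ₀ x * Θ₀ x ∂μ₀) →
      ∃ V : Set (Matrix (Fin N) (Fin N) (w.1.adicCompletion L)), V ∈ 𝓝 (0 : Matrix (Fin N) (Fin N) (w.1.adicCompletion L)) ∧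
      ∃ T : (↥(lieOfForm (galAdicCompletionMap (L := L) (IsCMField.complexConj L) hw) (UnitaryGroup.placeForm H w.1)) → ℂ) → ℂ,
        ((∀ f₁ f₂ : ↥(lieOfForm (galAdicCompletionMap (L := L) (IsCMField.complexConj L) hw) (UnitaryGroup.placeForm H w.1)) → ℂ, IsLocSmooth f₁ → IsLocSmooth f₂ → T (f₁ + f₂) = T f₁ + T f₂) ∧
         (∀ (a : ℂ) (f : ↥(lieOfForm (galAdicCompletionMap (L := L) (IsCMField.complexConj L) hw) (UnitaryGroup.placeForm H w.1)) → ℂ), IsLocSmooth f → T (a • f) = a * T f) ∧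
         (∀ (x : ↥(unitaryGroupOfForm (galAdicCompletionMap (L := L) (IsCMField.complexConj L) hw) (UnitaryGroup.placeForm H w.1))) (f : ↥(lieOfForm (galAdicCompletionMap (L := L) (IsCMField.complexConj L) hw) (UnitaryGroup.placeForm H w.1)) → ℂ), IsLocSmooth f →
            T (fun X => f ⟨((x : GL (Fin N) (w.1.adicCompletion L)) : Matrix (Fin N) (Fin N) (w.1.adicCompletion L)) * X.1 * (((x : GL (Fin N) (w.1.adicCompletion L))⁻¹ : GL (Fin N) (w.1.adicCompletion L)) : Matrix (Fin N) (Fin N) (w.1.adicCompletion L)),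
              conj_mem_lieOfForm x.2 X.2⟩) = T f) ∧
         (∀ f : ↥(lieOfForm (galAdicCompletionMap (L := L) (IsCMField.complexConj L) hw) (UnitaryGroup.placeForm H w.1)) → ℂ, IsLocSmooth f → (∀ X ∈ tsupport f, ¬ IsNilpotent X.1) → T f = 0)) ∧
        ∀ Fn : ↥(lieOfForm (galAdicCompletionMap (L := L) (IsCMField.complexConj L) hw) (UnitaryGroup.placeForm H w.1)) → ℂ,
          (∀ f : ↥(lieOfForm (galAdicCompletionMap (L := L) (IsCMField.complexConj L) hw) (UnitaryGroup.placeForm H w.1)) → ℂ, IsLocSmooth f → T (lieFourier (galAdicCompletionMap (L := L) (IsCMField.complexConj L) hw) (UnitaryGroup.placeForm H w.1) (fun x : w.1.adicCompletion L => ((ψ x : Circle) : ℂ)) μ𝔤 f) = ∫ X, f X * Fn X ∂μ𝔤) →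
          (∀ X : ↥(lieOfForm (galAdicCompletionMap (L := L) (IsCMField.complexConj L) hw) (UnitaryGroup.placeForm H w.1)), IsUnit X.1.charpoly.discr → ∀ᶠ Y in 𝓝 X, Fn Y = Fn X) →
          ∀ g : ↥(unitaryGroupOfForm (galAdicCompletionMap (L := L) (IsCMField.complexConj L) hw) (UnitaryGroup.placeForm H w.1)), ∀ Y : ↥(lieOfForm (galAdicCompletionMap (L := L) (IsCMField.complexConj L) hw) (UnitaryGroup.placeForm H w.1)), Y.1 ∈ V → IsUnit Y.1.charpoly.discr → IsUnit (1 - Y.1) → IsUnit (1 + Y.1) →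
            ((g : GL (Fin N) (w.1.adicCompletion L)) : Matrix (Fin N) (Fin N) (w.1.adicCompletion L)) = (1 + Y.1) * (1 - Y.1)⁻¹ → Θ₀ g = Fn Y)
    (hBU : ∀ (L : Type) [Field L] [NumberField L] [IsCMField L] (N : ℕ) (H : Matrix (Fin N) (Fin N) L),
      (H.map (cmConjRingHom L))ᵀ = H → H.det ≠ 0 →
      ∀ (v : HeightOneSpectrum (𝓞 ↥(maximalRealSubfield L))) (w : UnitaryGroup.PlacesOver L v) (hw : IsCMField.complexConj L • w.1 = w.1)
      (ψ : AddChar (w.1.adicCompletion L) Circle), ψ.IsContinuousNontrivial →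
      (∃ a : w.1.adicCompletion L, galAdicCompletionMap (L := L) (IsCMField.complexConj L) hw a = a ∧ ψ a ≠ 1) →
      ∀ [MeasurableSpace ↥(lieOfForm (galAdicCompletionMap (L := L) (IsCMField.complexConj L) hw) (UnitaryGroup.placeForm H w.1))]
        [BorelSpace ↥(lieOfForm (galAdicCompletionMap (L := L) (IsCMField.complexConj L) hw) (UnitaryGroup.placeForm H w.1))]
        (μ𝔤 : Measure ↥(lieOfForm (galAdicCompletionMap (L := L) (IsCMField.complexConj L) hw) (UnitaryGroup.placeForm H w.1))) [μ𝔤.IsAddHaarMeasure],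
      ∀ T : (↥(lieOfForm (galAdicCompletionMap (L := L) (IsCMField.complexConj L) hw) (UnitaryGroup.placeForm H w.1)) → ℂ) → ℂ,
        ((∀ f₁ f₂ : ↥(lieOfForm (galAdicCompletionMap (L := L) (IsCMField.complexConj L) hw) (UnitaryGroup.placeForm H w.1)) → ℂ, IsLocSmooth f₁ → IsLocSmooth f₂ → T (f₁ + f₂) = T f₁ + T f₂) ∧
         (∀ (a : ℂ) (f : ↥(lieOfForm (galAdicCompletionMap (L := L) (IsCMField.complexConj L) hw) (UnitaryGroup.placeForm H w.1)) → ℂ), IsLocSmooth f → T (a • f) = a * T f) ∧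
         (∀ (x : ↥(unitaryGroupOfForm (galAdicCompletionMap (L := L) (IsCMField.complexConj L) hw) (UnitaryGroup.placeForm H w.1))) (f : ↥(lieOfForm (galAdicCompletionMap (L := L) (IsCMField.complexConj L) hw) (UnitaryGroup.placeForm H w.1)) → ℂ), IsLocSmooth f →
            T (fun X => f ⟨((x : GL (Fin N) (w.1.adicCompletion L)) : Matrix (Fin N) (Fin N) (w.1.adicCompletion L)) * X.1 * (((x : GL (Fin N) (w.1.adicCompletion L))⁻¹ : GL (Fin N) (w.1.adicCompletion L)) : Matrix (Fin N) (Fin N) (w.1.adicCompletion L)),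
              conj_mem_lieOfForm x.2 X.2⟩) = T f) ∧
         (∀ f : ↥(lieOfForm (galAdicCompletionMap (L := L) (IsCMField.complexConj L) hw) (UnitaryGroup.placeForm H w.1)) → ℂ, IsLocSmooth f → (∀ X ∈ tsupport f, ¬ IsNilpotent X.1) → T f = 0)) →
        ∃ Fn : ↥(lieOfForm (galAdicCompletionMap (L := L) (IsCMField.complexConj L) hw) (UnitaryGroup.placeForm H w.1)) → ℂ, LocallyIntegrable Fn μ𝔤 ∧
          (∀ f : ↥(lieOfForm (galAdicCompletionMap (L := L) (IsCMField.complexConj L) hw) (UnitaryGroup.placeForm H w.1)) → ℂ, IsLocSmooth f → T (lieFourier (galAdicCompletionMap (L := L) (IsCMField.complexConj L) hw) (UnitaryGroup.placeForm H w.1) (fun x : w.1.adicCompletion L => ((ψ x : Circle) : ℂ)) μ𝔤 f) = ∫ X, f X * Fn X ∂μ𝔤) ∧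
          (∀ X : ↥(lieOfForm (galAdicCompletionMap (L := L) (IsCMField.complexConj L) hw) (UnitaryGroup.placeForm H w.1)), IsUnit X.1.charpoly.discr → ∀ᶠ Y in 𝓝 X, Fn Y = Fn X) ∧
          (∀ C : Set ↥(lieOfForm (galAdicCompletionMap (L := L) (IsCMField.complexConj L) hw) (UnitaryGroup.placeForm H w.1)), IsCompact C → ∃ B : ℝ, ∀ X ∈ C,
              ((NNReal.sqrt (NNReal.sqrt (normAbs (w.1.adicCompletion L) X.1.charpoly.discr)) : ℝ≥0) : ℝ) * ‖Fn X‖ ≤ B))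
    (hD : ∀ (L : Type) [Field L] [NumberField L] [IsCMField L] (N : ℕ) (H : Matrix (Fin N) (Fin N) L),
      (H.map (cmConjRingHom L))ᵀ = H → H.det ≠ 0 →
      ∀ (v : HeightOneSpectrum (𝓞 ↥(maximalRealSubfield L)))
        [MeasurableSpace ((UnitaryGroup.cmDatum L N H).Local v)] [BorelSpace ((UnitaryGroup.cmDatum L N H).Local v)]
        (μ : Measure ((UnitaryGroup.cmDatum L N H).Local v)) [μ.IsHaarMeasure]
        (c : IrrClass ((UnitaryGroup.cmDatum L N H).Local v)) (Θ : (UnitaryGroup.cmDatum L N H).Local v → ℂ),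
        LocallyIntegrable Θ μ →
        (∀ x : (UnitaryGroup.cmDatum L N H).Local v,
          IsRegularElt (x.val : GL (Fin N) (UnitaryGroup.LocalRing L v)) → ∀ᶠ y in 𝓝 x, Θ y = Θ x) →
        (∀ φ : (UnitaryGroup.cmDatum L N H).Local v → ℂ, IsLocSmooth φ → c.smoothTrace μ φ = ∫ x, φ x * Θ x ∂μ) →
      ∀ s : (UnitaryGroup.cmDatum L N H).Local v, Module.End.IsSemisimple (Matrix.toLin' ((s.val : GL (Fin N) (UnitaryGroup.LocalRing L v)).val : Matrix (Fin N) (Fin N) (UnitaryGroup.LocalRing L v))) →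
        ¬ IsRegularElt (s.val : GL (Fin N) (UnitaryGroup.LocalRing L v)) → s ∉ Subgroup.center ((UnitaryGroup.cmDatum L N H).Local v) →
        ∃ U : Set ((UnitaryGroup.cmDatum L N H).Local v), IsOpen U ∧ s ∈ U ∧
        ∃ B : ℝ, ∀ g ∈ U, ∀ u : (UnitaryGroup.LocalRing L v)ˣ,
          (u : UnitaryGroup.LocalRing L v) *
              (((g.val : GL (Fin N) (UnitaryGroup.LocalRing L v)).val : Matrix (Fin N) (Fin N) (UnitaryGroup.LocalRing L v)).det) ^ (N - 1) =
            (((g.val : GL (Fin N) (UnitaryGroup.LocalRing L v)).val : Matrix (Fin N) (Fin N) (UnitaryGroup.LocalRing L v)).charpoly).discr →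
          ((NNReal.sqrt (NNReal.sqrt (unitModulusChar (UnitaryGroup.LocalRing L v) u)) : ℝ≥0) : ℝ) * ‖Θ g‖ ≤ B) :
    ∀ (L : Type) [Field L] [NumberField L] [IsCMField L] (N : ℕ) (H : Matrix (Fin N) (Fin N) L),
      (H.map (cmConjRingHom L))ᵀ = H → H.det ≠ 0 →
      ∀ (v : HeightOneSpectrum (𝓞 ↥(maximalRealSubfield L)))
        [MeasurableSpace ((UnitaryGroup.cmDatum L N H).Local v)] [BorelSpace ((UnitaryGroup.cmDatum L N H).Local v)]
        (μ : Measure ((UnitaryGroup.cmDatum L N H).Local v)) [μ.IsHaarMeasure]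
        (c : IrrClass ((UnitaryGroup.cmDatum L N H).Local v)) (Θ : (UnitaryGroup.cmDatum L N H).Local v → ℂ),
        LocallyIntegrable Θ μ →
        (∀ x : (UnitaryGroup.cmDatum L N H).Local v,
          IsRegularElt (x.val : GL (Fin N) (UnitaryGroup.LocalRing L v)) → ∀ᶠ y in 𝓝 x, Θ y = Θ x) →
        (∀ φ : (UnitaryGroup.cmDatum L N H).Local v → ℂ, IsLocSmooth φ → c.smoothTrace μ φ = ∫ x, φ x * Θ x ∂μ) →
      ∀ s : (UnitaryGroup.cmDatum L N H).Local v, Module.End.IsSemisimple (Matrix.toLin' ((s.val : GL (Fin N) (UnitaryGroup.LocalRing L v)).val : Matrix (Fin N) (Fin N) (UnitaryGroup.LocalRing L v))) →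
        ∃ V : Set (Matrix (Fin N) (Fin N) (UnitaryGroup.LocalRing L v)), V ∈ 𝓝 (0 : Matrix (Fin N) (Fin N) (UnitaryGroup.LocalRing L v)) ∧
        ∃ B : ℝ, ∀ y : (UnitaryGroup.cmDatum L N H).Local v,
          (∃ Y ∈ V, (Y.map (UnitaryGroup.conjLocal L (IsCMField.complexConj L) v))ᵀ * ((UnitaryGroup.adelicForm L N H).map (UnitaryGroup.adeleToLocal L v)) = -(((UnitaryGroup.adelicForm L N H).map (UnitaryGroup.adeleToLocal L v)) * Y) ∧
            ((s.val : GL (Fin N) (UnitaryGroup.LocalRing L v)).val : Matrix (Fin N) (Fin N) (UnitaryGroup.LocalRing L v)) * Y = Y * ((s.val : GL (Fin N) (UnitaryGroup.LocalRing L v)).val : Matrix (Fin N) (Fin N) (UnitaryGroup.LocalRing L v)) ∧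
            IsUnit (1 - Y) ∧ IsUnit (1 + Y) ∧
            ((y.val : GL (Fin N) (UnitaryGroup.LocalRing L v)).val : Matrix (Fin N) (Fin N) (UnitaryGroup.LocalRing L v)) = ((s.val : GL (Fin N) (UnitaryGroup.LocalRing L v)).val : Matrix (Fin N) (Fin N) (UnitaryGroup.LocalRing L v)) * ((1 + Y) * (1 - Y)⁻¹)) →
          ∀ u : (UnitaryGroup.LocalRing L v)ˣ,
          (u : UnitaryGroup.LocalRing L v) *
              (((y.val : GL (Fin N) (UnitaryGroup.LocalRing L v)).val : Matrix (Fin N) (Fin N) (UnitaryGroup.LocalRing L v)).det) ^ (N - 1) =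
            (((y.val : GL (Fin N) (UnitaryGroup.LocalRing L v)).val : Matrix (Fin N) (Fin N) (UnitaryGroup.LocalRing L v)).charpoly).discr →
          ((NNReal.sqrt (NNReal.sqrt (unitModulusChar (UnitaryGroup.LocalRing L v) u)) : ℝ≥0) : ℝ) * ‖Θ y‖ ≤ B :=
  normalizedCharBddOnCayleySlice_of_identity_of_descent hg (normalizedCharBddNearIdentity_of_lieCore' hg hAGL hBGL hAU hBU) hD

end Summit.HodgeConjecture.HodgeConjecture.Cruxes.H413.K2E3NormalizedCharBddOnCayleySliceOfLieCoreFixed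

end
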